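import Literature.Probability.Percolation.LoopDensity
import Literature.Probability.Percolation.InterfaceLoopWindingSign
import HarnessLib

/-!
# The S25 proxy chain from DKKMO's printed Theorem 1.7, given boundary regularity and fatness on `ℤ²`

Topic: Probability / Percolation (crit-perc.S25 cone). Bookkeeping layer above
`IsoradialRectangularLoopsBridge` (`dkkmo_universality_coupling_of_theorem_1_7 :
dkkmo_theorem_1_7 → (winding signs on ℤ²) → (ℤ² regularity w.h.p.) → dkkmo_universality_coupling`),
discharging what the tree now proves of its two `ℤ²` inputs:

* the **winding signs** are the theorem `interfaceLoop_windingSigns`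
  (`InterfaceLoopWindingSign.lean`: interface loops of type `1` wind in `{0, 1}`, of type `0` in
  `{0, -1}`);
* the **density** third of the regularity hypothesis is the theorem
  `exists_isDense_bondTypedLoops` (`LoopDensity.lean`: isolated vertices of `(2ℤ)²`).

Results:

* `z2Regularity_of_boundary_fat` — the regularity hypothesis `hreg` of the bridge follows from its
  boundary-regularity and fatness parts alone (same shape, same good events, one scale `r(δ)`
  with `√δ ≤ r(δ) ≤ C₂ δ^{c₂}`): density at scale `η = r(δ)` in the window `closedBall 0 (R - ε)`
  fails with probability `≤ (16R + 5)² δ⁻¹ · 6·16³·512³ δ³ = K δ²`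
  (`fifteen_sixteenths_rpow_le`: `(15/16)^t ≤ 6·16³/t³`), after restricting to meshes with
  `32√2 δ ≤ √δ` (`thirtytwo_mul_sqrt_two_mul_le_sqrt`) and `r(δ) + ε ≤ R`.
* `dkkmo_universality_coupling_of_theorem_1_7_of_boundary_fat`,
  `dkkmo_rotation_invariance_of_theorem_1_7_of_boundary_fat` — the tree's
  `dkkmo_universality_coupling` and crit-perc.S25 `dkkmo_rotation_invariance` from the printed
  Theorem 1.7 (`dkkmo_theorem_1_7`) and the two remaining `ℤ²` estimates (boundary regularity of
  `bondTypedLoops (√2δ) (π/4)` at `(R - ε, 2ε, r - 4ε)` and fatness at scale `ε` above diameter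
  `r - 2ε` inside `closedBall 0 (R + ε)`, with high probability), stated as one explicit
  hypothesis. Conditional reductions: nothing is discharged, no named fact is introduced.

What is NOT here: Theorem 1.7 itself, and the two remaining estimates (a boundary three-arm /
window-averaging bound and a thin-macroscopic-loop bound for critical bond percolation on `ℤ²`;
both rest on counting distinct large interface loops, i.e. on the lattice Jordan package).

## References

* H. Duminil-Copin, K. K. Kozlowski, D. Krachun, I. Manolescu, M. Oulamara, *Rotational
  invariance in critical planar lattice models*, arXiv:2012.11672v2 (2026), Theorem 1.7, §1.2,
  Remark 1.8 [arXiv201211672v2].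
* G. Grimmett, *Percolation*, 2nd ed., Springer (1999), §1.3, §11.2 [Grimmett1999].
-/

noncomputable section

open Set Metric MeasureTheory
open scoped ENNReal Real

namespace Literature.Probability.Percolation

open LatticeModels RandomPlanarGeometry

/-! ### An elementary decay bound: `(15/16)^{1/(512 δ)}` is `O(δ³)` -/

/-- `(15/16)^t ≤ 6 · 16³ / t³` for `t > 0`: `15/16 ≤ e^{-1/16}` and `e^{-u} ≤ 3!/u³`. [folklore] -/
theorem fifteen_sixteenths_rpow_le {t : ℝ} (ht : 0 < t) :
    (15 / 16 : ℝ) ^ t ≤ 6 * 16 ^ 3 / t ^ 3 := by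
  have h1 : (15 / 16 : ℝ) ≤ Real.exp (-(1 / 16)) := by
    linarith [Real.add_one_le_exp (-(1 / 16 : ℝ))]
  have h2 : (15 / 16 : ℝ) ^ t ≤ Real.exp (-(1 / 16)) ^ t :=
    Real.rpow_le_rpow (by norm_num) h1 ht.le
  have h3 : Real.exp (-(1 / 16)) ^ t = Real.exp (-(t / 16)) := by
    rw [← Real.exp_mul]; congr 1; ring
  have hu : 0 < t / 16 := by positivity
  have h4 : (t / 16) ^ 3 / (3 : ℕ).factorial ≤ Real.exp (t / 16) := Real.pow_div_factorial_le_exp (t / 16) hu.le 3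
  have hfact : ((3 : ℕ).factorial : ℝ) = 6 := by norm_num [Nat.factorial]
  rw [hfact] at h4
  have h5 : Real.exp (-(t / 16)) ≤ 6 / (t / 16) ^ 3 := by
    rw [Real.exp_neg, inv_le_comm₀ (Real.exp_pos _) (by positivity), inv_div]
    exact h4
  have h6 : (6 : ℝ) / (t / 16) ^ 3 = 6 * 16 ^ 3 / t ^ 3 := by
    rw [div_pow, div_div_eq_mul_div]
  calc (15 / 16 : ℝ) ^ t ≤ Real.exp (-(1 / 16)) ^ t := h2
    _ = Real.exp (-(t / 16)) := h3
    _ ≤ 6 / (t / 16) ^ 3 := h5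
    _ = 6 * 16 ^ 3 / t ^ 3 := h6

/-- On `(0, 1/2048]`, `32 · (√2 δ) ≤ √δ` (the density theorem's scale condition at the finest
admissible scale `√δ`). [folklore] -/
theorem thirtytwo_mul_sqrt_two_mul_le_sqrt {δ : ℝ} (hδ : 0 ≤ δ) (hδ' : δ ≤ 1 / 2048) :
    32 * (Real.sqrt 2 * δ) ≤ Real.sqrt δ := by
  have h0 : 0 ≤ 32 * (Real.sqrt 2 * δ) := by positivity
  rw [← Real.sqrt_sq h0]
  apply Real.sqrt_le_sqrt
  have h2 : Real.sqrt 2 ^ 2 = 2 := Real.sq_sqrt (by norm_num)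
  have h3 : (32 * (Real.sqrt 2 * δ)) ^ 2 = 2048 * δ ^ 2 := by rw [mul_pow, mul_pow, h2]; ring
  rw [h3]
  nlinarith [hδ, hδ']

/-- **The density input is free.** The `ℤ²` regularity hypothesis `hreg` of
`dkkmo_universality_coupling_of_theorem_1_7` (boundary regularity, density and fatness of
`bondTypedLoops (√2 δ) (π/4)` with high probability along a tolerance schedule `ε = C₁ δ^{c₁}`)
follows from its boundary-regularity and fatness parts alone, with the single scale `r(δ)`
required to satisfy `√δ ≤ r(δ) ≤ C₂ δ^{c₂}`: the density part at scale `η = r(δ)` in the window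
`closedBall 0 (R - ε)` is supplied by `exists_isDense_bondTypedLoops` (`LoopDensity.lean`), whose
failure probability `(16 R'/η + 5)² (15/16)^{(η/(16√2δ))²} ≤ (16R + 5)² δ⁻¹ · 6·16³·512³ δ³` is
polynomially small (`fifteen_sixteenths_rpow_le`); meshes are restricted to
`δ ≤ min(δ₀, 1/2048, (R/2/(C₂⁺+1))^{1/c₂}, (R/2/C₁)^{1/c₁})` so that `32√2 δ ≤ √δ` and
`r(δ) + ε ≤ R`. [folklore] -/
theorem z2Regularity_of_boundary_fat
    (h : ∀ R : ℝ, 0 < R → ∀ C₁ c₁ : ℝ, 0 < C₁ → 0 < c₁ →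
      ∃ C₂ c₂ δ₀ : ℝ, 0 < c₂ ∧ 0 < δ₀ ∧ ∃ r : ℝ → ℝ, ∀ δ : ℝ, 0 < δ → δ ≤ δ₀ →
        Real.sqrt δ ≤ r δ ∧ r δ ≤ C₂ * δ ^ c₂ ∧
        ∃ G : Set (BondConfig (Site 2)), MeasurableSet G ∧
          bondPercolation (zdGraph 2) half Gᶜ ≤ ENNReal.ofReal (C₂ * δ ^ c₂) ∧
          ∀ ω ∈ G,
            (bondTypedLoops (Real.sqrt 2 * δ) (π / 4) ω).BoundaryRegular (R - C₁ * δ ^ c₁)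
                (2 * (C₁ * δ ^ c₁)) (r δ - 4 * (C₁ * δ ^ c₁)) ∧
            ∀ c ∈ (bondTypedLoops (Real.sqrt 2 * δ) (π / 4) ω).all,
              r δ - 2 * (C₁ * δ ^ c₁) ≤ Metric.diam c.range →
              c.range ⊆ Metric.closedBall 0 (R + C₁ * δ ^ c₁) →
                ∃ z, C₁ * δ ^ c₁ < Metric.infDist z c.range ∧ c.wind z ≠ 0) :
    ∀ R : ℝ, 0 < R → ∀ C₁ c₁ : ℝ, 0 < C₁ → 0 < c₁ →
      ∃ C₂ c₂ δ₀ : ℝ, 0 < c₂ ∧ 0 < δ₀ ∧ ∃ r η : ℝ → ℝ, ∀ δ : ℝ, 0 < δ → δ ≤ δ₀ →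
        r δ ≤ η δ + 2 * (C₁ * δ ^ c₁) ∧ 0 ≤ η δ ∧ η δ ≤ C₂ * δ ^ c₂ ∧
        ∃ G : Set (BondConfig (Site 2)), MeasurableSet G ∧
          bondPercolation (zdGraph 2) half Gᶜ ≤ ENNReal.ofReal (C₂ * δ ^ c₂) ∧
          ∀ ω ∈ G,
            (bondTypedLoops (Real.sqrt 2 * δ) (π / 4) ω).BoundaryRegular (R - C₁ * δ ^ c₁)
                (2 * (C₁ * δ ^ c₁)) (r δ - 4 * (C₁ * δ ^ c₁)) ∧
            (bondTypedLoops (Real.sqrt 2 * δ) (π / 4) ω).IsDense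
                (Metric.closedBall 0 (R - C₁ * δ ^ c₁)) (η δ) ∧
            ∀ c ∈ (bondTypedLoops (Real.sqrt 2 * δ) (π / 4) ω).all,
              r δ - 2 * (C₁ * δ ^ c₁) ≤ Metric.diam c.range →
              c.range ⊆ Metric.closedBall 0 (R + C₁ * δ ^ c₁) →
                ∃ z, C₁ * δ ^ c₁ < Metric.infDist z c.range ∧ c.wind z ≠ 0 := by
  intro R hR C₁ c₁ hC₁ hc₁
  obtain ⟨C₂, c₂, δ₀, hc₂, hδ₀, r, hr⟩ := h R hR C₁ c₁ hC₁ hc₁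
  -- constants
  set M₂ : ℝ := max C₂ 0 with hM₂
  have hM₂0 : 0 ≤ M₂ := le_max_right _ _
  set K : ℝ := 6 * 16 ^ 3 * 512 ^ 3 * (16 * R + 5) ^ 2 with hK
  have hK0 : 0 ≤ K := by rw [hK]; positivity
  set c : ℝ := min c₂ 1 with hc
  have hc0 : 0 < c := lt_min hc₂ one_pos
  have hcc₂ : c ≤ c₂ := min_le_left _ _
  have hc1 : c ≤ 1 := min_le_right _ _
  set δ₁ : ℝ := min δ₀ (min (1 / 2048) (min ((R / 2 / (M₂ + 1)) ^ c₂⁻¹) ((R / 2 / C₁) ^ c₁⁻¹))) with hδ₁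
  have hRM : 0 < R / 2 / (M₂ + 1) := div_pos (half_pos hR) (by linarith)
  have hRC : 0 < R / 2 / C₁ := div_pos (half_pos hR) hC₁
  have hδ₁0 : 0 < δ₁ := lt_min hδ₀ (lt_min (by norm_num)
    (lt_min (Real.rpow_pos_of_pos hRM _) (Real.rpow_pos_of_pos hRC _)))
  refine ⟨M₂ + K, c, δ₁, hc0, hδ₁0, r, r, fun δ hδ0 hδδ₁ ↦ ?_⟩
  have hδδ₀ : δ ≤ δ₀ := hδδ₁.trans (min_le_left _ _)
  have hδ2048 : δ ≤ 1 / 2048 := hδδ₁.trans ((min_le_right _ _).trans (min_le_left _ _))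
  have hδ1 : δ ≤ 1 := hδ2048.trans (by norm_num)
  obtain ⟨hsqrt, hrC, G, hG, hGc, hgood⟩ := hr δ hδ0 hδδ₀
  set ε : ℝ := C₁ * δ ^ c₁ with hε
  have hε0 : 0 < ε := mul_pos hC₁ (Real.rpow_pos_of_pos hδ0 _)
  have hsqrt0 : 0 < Real.sqrt δ := Real.sqrt_pos.2 hδ0
  have hr0 : 0 < r δ := hsqrt0.trans_le hsqrt
  -- `ε ≤ R/2` and `r δ ≤ R/2`
  have hεR : ε ≤ R / 2 := by
    have h1 : δ ≤ (R / 2 / C₁) ^ c₁⁻¹ :=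
      hδδ₁.trans ((min_le_right _ _).trans ((min_le_right _ _).trans (min_le_right _ _)))
    have h2 : δ ^ c₁ ≤ ((R / 2 / C₁) ^ c₁⁻¹) ^ c₁ := Real.rpow_le_rpow hδ0.le h1 hc₁.le
    rw [Real.rpow_inv_rpow hRC.le hc₁.ne'] at h2
    calc ε = C₁ * δ ^ c₁ := rfl
      _ ≤ C₁ * (R / 2 / C₁) := mul_le_mul_of_nonneg_left h2 hC₁.le
      _ = R / 2 := mul_div_cancel₀ _ hC₁.ne'
  have hrR : r δ ≤ R / 2 := by
    have h1 : δ ≤ (R / 2 / (M₂ + 1)) ^ c₂⁻¹ :=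
      hδδ₁.trans ((min_le_right _ _).trans ((min_le_right _ _).trans (min_le_left _ _)))
    have h2 : δ ^ c₂ ≤ ((R / 2 / (M₂ + 1)) ^ c₂⁻¹) ^ c₂ := Real.rpow_le_rpow hδ0.le h1 hc₂.le
    rw [Real.rpow_inv_rpow hRM.le hc₂.ne'] at h2
    have hM1 : (0 : ℝ) < M₂ + 1 := by linarith
    calc r δ ≤ C₂ * δ ^ c₂ := hrC
      _ ≤ (M₂ + 1) * δ ^ c₂ :=
          mul_le_mul_of_nonneg_right ((le_max_left _ _).trans (by linarith)) (Real.rpow_nonneg hδ0.le _)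
      _ ≤ (M₂ + 1) * (R / 2 / (M₂ + 1)) := mul_le_mul_of_nonneg_left h2 hM1.le
      _ = R / 2 := mul_div_cancel₀ _ hM1.ne'
  -- the density event at scale `r δ` in the window `closedBall 0 (R - ε)`
  have hmesh : 0 < Real.sqrt 2 * δ := by positivity
  obtain ⟨D, hD, hDc, hdense⟩ := exists_isDense_bondTypedLoops (π / 4) hmesh
    ((thirtytwo_mul_sqrt_two_mul_le_sqrt hδ0.le hδ2048).trans hsqrt) (show r δ ≤ R - ε by linarith)
  -- its failure probability is `≤ K δ²`
  have hDc' : bondPercolation (zdGraph 2) half Dᶜ ≤ ENNReal.ofReal (K * δ ^ 2) := by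
    refine hDc.trans (ENNReal.ofReal_le_ofReal ?_)
    have hA : (16 * (R - ε) / r δ + 5) ^ 2 ≤ (16 * R + 5) ^ 2 / δ := by
      have hsle1 : Real.sqrt δ ≤ 1 := by rw [← Real.sqrt_one]; exact Real.sqrt_le_sqrt hδ1
      have h1 : (R - ε) / r δ ≤ R / Real.sqrt δ := by
        rw [div_le_div_iff₀ hr0 hsqrt0]
        nlinarith [mul_le_mul_of_nonneg_left hsqrt hR.le, mul_nonneg hε0.le hsqrt0.le]
      have h2 : (5 : ℝ) ≤ 5 / Real.sqrt δ := by
        rw [le_div_iff₀ hsqrt0]; nlinarith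
      have h3 : 16 * (R - ε) / r δ + 5 ≤ (16 * R + 5) / Real.sqrt δ := by
        rw [mul_div_assoc, add_div, mul_div_assoc]; linarith
      have h4 : 0 ≤ 16 * (R - ε) / r δ + 5 := by
        have : 0 ≤ 16 * (R - ε) / r δ := div_nonneg (by linarith) hr0.le
        linarith
      calc (16 * (R - ε) / r δ + 5) ^ 2 ≤ ((16 * R + 5) / Real.sqrt δ) ^ 2 := pow_le_pow_left₀ h4 h3 2
        _ = (16 * R + 5) ^ 2 / δ := by rw [div_pow, Real.sq_sqrt hδ0.le]
    have hB : (15 / 16 : ℝ) ^ ((r δ / (16 * (Real.sqrt 2 * δ))) ^ 2) ≤ 6 * 16 ^ 3 * 512 ^ 3 * δ ^ 3 := by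
      have ht : 1 / (512 * δ) ≤ (r δ / (16 * (Real.sqrt 2 * δ))) ^ 2 := by
        have h1 : Real.sqrt δ / (16 * (Real.sqrt 2 * δ)) ≤ r δ / (16 * (Real.sqrt 2 * δ)) :=
          div_le_div_of_nonneg_right hsqrt (by positivity)
        have hδne : δ ≠ 0 := hδ0.ne'
        have h2 : (Real.sqrt δ / (16 * (Real.sqrt 2 * δ))) ^ 2 = 1 / (512 * δ) := by
          rw [div_pow, Real.sq_sqrt hδ0.le, mul_pow, mul_pow, Real.sq_sqrt (by norm_num),
            div_eq_div_iff (by positivity) (by positivity)]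
          ring
        rw [← h2]
        exact pow_le_pow_left₀ (by positivity) h1 2
      calc (15 / 16 : ℝ) ^ ((r δ / (16 * (Real.sqrt 2 * δ))) ^ 2)
          ≤ (15 / 16 : ℝ) ^ (1 / (512 * δ)) := Real.rpow_le_rpow_of_exponent_ge (by norm_num) (by norm_num) ht
        _ ≤ 6 * 16 ^ 3 / (1 / (512 * δ)) ^ 3 := fifteen_sixteenths_rpow_le (by positivity)
        _ = 6 * 16 ^ 3 * 512 ^ 3 * δ ^ 3 := by rw [one_div, inv_pow, div_inv_eq_mul]; ring
    calc (16 * (R - ε) / r δ + 5) ^ 2 * (15 / 16 : ℝ) ^ ((r δ / (16 * (Real.sqrt 2 * δ))) ^ 2)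
        ≤ (16 * R + 5) ^ 2 / δ * (6 * 16 ^ 3 * 512 ^ 3 * δ ^ 3) :=
          mul_le_mul hA hB (Real.rpow_nonneg (by norm_num) _) (by positivity)
      _ = K * δ ^ 2 := by rw [hK, div_mul_eq_mul_div, div_eq_iff hδ0.ne']; ring
  -- exponents and constants
  have hδc₂ : δ ^ c₂ ≤ δ ^ c := Real.rpow_le_rpow_of_exponent_ge hδ0 hδ1 hcc₂
  have hδ2 : δ ^ (2 : ℕ) ≤ δ ^ c := by
    rw [← Real.rpow_natCast]
    exact Real.rpow_le_rpow_of_exponent_ge hδ0 hδ1 (by push_cast; linarith)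
  have hC₂c : C₂ * δ ^ c₂ ≤ M₂ * δ ^ c :=
    (mul_le_mul_of_nonneg_right (le_max_left _ _) (Real.rpow_nonneg hδ0.le _)).trans
      (mul_le_mul_of_nonneg_left hδc₂ hM₂0)
  have hKc : K * δ ^ 2 ≤ K * δ ^ c := mul_le_mul_of_nonneg_left hδ2 hK0
  refine ⟨by linarith, hr0.le, hrC.trans (hC₂c.trans (by nlinarith [Real.rpow_nonneg hδ0.le c])),
    G ∩ D, hG.inter hD, ?_, fun ω hω ↦ ?_⟩
  · calc bondPercolation (zdGraph 2) half (G ∩ D)ᶜ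
        = bondPercolation (zdGraph 2) half (Gᶜ ∪ Dᶜ) := by rw [Set.compl_inter]
      _ ≤ bondPercolation (zdGraph 2) half Gᶜ + bondPercolation (zdGraph 2) half Dᶜ := measure_union_le _ _
      _ ≤ ENNReal.ofReal (C₂ * δ ^ c₂) + ENNReal.ofReal (K * δ ^ 2) := add_le_add hGc hDc'
      _ = ENNReal.ofReal (C₂ * δ ^ c₂ + K * δ ^ 2) :=
          (ENNReal.ofReal_add (hr0.le.trans hrC) (mul_nonneg hK0 (sq_nonneg δ))).symm
      _ ≤ ENNReal.ofReal ((M₂ + K) * δ ^ c) := by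
          apply ENNReal.ofReal_le_ofReal
          calc C₂ * δ ^ c₂ + K * δ ^ 2 ≤ M₂ * δ ^ c + K * δ ^ c := add_le_add hC₂c hKc
            _ = (M₂ + K) * δ ^ c := by ring
  · obtain ⟨hB, hfat⟩ := hgood ω hω.1
    exact ⟨hB, hdense ω hω.2, hfat⟩

/-! ### The S25 proxy chain from Theorem 1.7 as printed, given boundary regularity and fatness on `ℤ²` -/

/-- **`dkkmo_universality_coupling` from the printed Theorem 1.7 and the two remaining `ℤ²`
inputs** — boundary regularity and fatness of the interface loops of critical bond percolation on
`√2 δ e^{iπ/4} ℤ²` with high probability (the hypothesis `h`, in the shape of the `hreg` of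
`dkkmo_universality_coupling_of_theorem_1_7` without its density part, scale `√δ ≤ r(δ) ≤ C₂δ^{c₂}`):
the winding signs are the theorem `interfaceLoop_windingSigns` (`InterfaceLoopWindingSign.lean`)
and the density part is `z2Regularity_of_boundary_fat` (`LoopDensity.lean`). A conditional
reduction; nothing is discharged. [cite: arXiv201211672v2, Thm 1.7, §1.2] -/
theorem dkkmo_universality_coupling_of_theorem_1_7_of_boundary_fat (h17 : dkkmo_theorem_1_7)
    (h : ∀ R : ℝ, 0 < R → ∀ C₁ c₁ : ℝ, 0 < C₁ → 0 < c₁ →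
      ∃ C₂ c₂ δ₀ : ℝ, 0 < c₂ ∧ 0 < δ₀ ∧ ∃ r : ℝ → ℝ, ∀ δ : ℝ, 0 < δ → δ ≤ δ₀ →
        Real.sqrt δ ≤ r δ ∧ r δ ≤ C₂ * δ ^ c₂ ∧
        ∃ G : Set (BondConfig (Site 2)), MeasurableSet G ∧
          bondPercolation (zdGraph 2) half Gᶜ ≤ ENNReal.ofReal (C₂ * δ ^ c₂) ∧
          ∀ ω ∈ G,
            (bondTypedLoops (Real.sqrt 2 * δ) (π / 4) ω).BoundaryRegular (R - C₁ * δ ^ c₁)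
                (2 * (C₁ * δ ^ c₁)) (r δ - 4 * (C₁ * δ ^ c₁)) ∧
            ∀ c ∈ (bondTypedLoops (Real.sqrt 2 * δ) (π / 4) ω).all,
              r δ - 2 * (C₁ * δ ^ c₁) ≤ Metric.diam c.range →
              c.range ⊆ Metric.closedBall 0 (R + C₁ * δ ^ c₁) →
                ∃ z, C₁ * δ ^ c₁ < Metric.infDist z c.range ∧ c.wind z ≠ 0) :
    dkkmo_universality_coupling :=
  dkkmo_universality_coupling_of_theorem_1_7 h17 interfaceLoop_windingSigns (z2Regularity_of_boundary_fat h)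

/-- **crit-perc.S25 (`dkkmo_rotation_invariance`) from the printed Theorem 1.7 and the two
remaining `ℤ²` inputs** (boundary regularity and fatness with high probability), via
`dkkmo_rotation_invariance_of_theorem_1_7`, `interfaceLoop_windingSigns` and
`z2Regularity_of_boundary_fat`. A conditional reduction; nothing is discharged. [cite: arXiv201211672v2, Thm 1.7, Remark 1.8] -/
theorem dkkmo_rotation_invariance_of_theorem_1_7_of_boundary_fat (h17 : dkkmo_theorem_1_7)
    (h : ∀ R : ℝ, 0 < R → ∀ C₁ c₁ : ℝ, 0 < C₁ → 0 < c₁ →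
      ∃ C₂ c₂ δ₀ : ℝ, 0 < c₂ ∧ 0 < δ₀ ∧ ∃ r : ℝ → ℝ, ∀ δ : ℝ, 0 < δ → δ ≤ δ₀ →
        Real.sqrt δ ≤ r δ ∧ r δ ≤ C₂ * δ ^ c₂ ∧
        ∃ G : Set (BondConfig (Site 2)), MeasurableSet G ∧
          bondPercolation (zdGraph 2) half Gᶜ ≤ ENNReal.ofReal (C₂ * δ ^ c₂) ∧
          ∀ ω ∈ G,
            (bondTypedLoops (Real.sqrt 2 * δ) (π / 4) ω).BoundaryRegular (R - C₁ * δ ^ c₁)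
                (2 * (C₁ * δ ^ c₁)) (r δ - 4 * (C₁ * δ ^ c₁)) ∧
            ∀ c ∈ (bondTypedLoops (Real.sqrt 2 * δ) (π / 4) ω).all,
              r δ - 2 * (C₁ * δ ^ c₁) ≤ Metric.diam c.range →
              c.range ⊆ Metric.closedBall 0 (R + C₁ * δ ^ c₁) →
                ∃ z, C₁ * δ ^ c₁ < Metric.infDist z c.range ∧ c.wind z ≠ 0) :
    dkkmo_rotation_invariance :=
  dkkmo_rotation_invariance_of_theorem_1_7 h17 interfaceLoop_windingSigns (z2Regularity_of_boundary_fat h)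

end Literature.Probability.Percolation

end
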